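import Mathlib.Analysis.InnerProductSpace.PiL2
import Mathlib.Analysis.Complex.Basic
import Mathlib.Topology.Algebra.Module.FiniteDimension
import Mathlib.Analysis.Calculus.FDeriv.Mul
import Mathlib.Analysis.Calculus.FDeriv.Bilinear
import Mathlib.Analysis.Calculus.FDeriv.RestrictScalars
import Mathlib.Analysis.Calculus.Deriv.Inv
import Mathlib.Analysis.Calculus.ContDiff.FiniteDimension
import Mathlib.Analysis.Calculus.DifferentialForm.Basic
import Literature.NumberTheory.Transcendental.ProjectiveSpaceProofs
import Literature.Geometry.Kaehler.KaehlerProofs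
import Literature.AlgebraicGeometry.Motives.GAGA
import HarnessLib

/-!
# `ℙⁿ(ℂ)` is a Kähler manifold: the Fubini–Study metric (proof file)

Family `hodge`, layer `Literature/AlgebraicGeometry/Motives`. Sibling proof file of `GAGA.lean`,
which vendors the named fact `Literature.AlgebraicGeometry.Motives.isKaehlerManifold_projectivization`
("`ℙⁿ(ℂ)` with its standard atlas is a Kähler manifold: the Fubini–Study metric",
Griffiths–Harris pp. 30–31, 109; Voisin I, Ex. 3.10). This file **discharges that fact**
(`Literature.AlgebraicGeometry.Motives.isKaehlerManifold_projectivization_holds`): it constructs the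
Fubini–Study metric as a `C^∞` Riemannian metric (`Bundle.ContMDiffRiemannianMetric`) on Mathlib's
real tangent bundle of `ℙ ℂ ℂⁿ⁺¹` (charted by the standard affine atlas of
`Literature/NumberTheory/Transcendental/ProjectiveSpace.lean`), proves that it is Hermitian
(`Bundle.RiemannianMetric.IsHermitian`) and that its Kähler form is closed for the honest manifold
exterior derivative `Literature.Geometry.Kaehler.mextDeriv` (`Bundle.RiemannianMetric.IsKaehler`),
whence `Literature.Geometry.Kaehler.IsKaehlerManifold ℂⁿ ℙⁿ(ℂ)`.

## The printed argument

Huybrechts, *Complex Geometry*, §3.1, Examples 3.1.9 i), pp. 117–118: on the standard chart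
`φᵢ : Uᵢ = {zᵢ ≠ 0} → ℂⁿ` put `ωᵢ = (i/2π) ∂∂̄ log(Σₗ |z_ℓ/zᵢ|²)`, i.e. `(i/2π) ∂∂̄ log(1 + Σ|w_k|²)`
in the coordinates `w = φᵢ(z)`; (a) the `ωᵢ` glue (`ωᵢ = ωⱼ` on `Uᵢ ∩ Uⱼ`, since the two
potentials differ by `log |zⱼ/zᵢ|²`, which is `∂∂̄`-closed); (b) `ω` is a real closed `(1,1)`-form
(`dωᵢ = (i/2π)(∂ + ∂̄)∂∂̄ log = 0`); (c) `ω` is positive: "a straightforward computation yields"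
`∂∂̄ log(1 + Σ|wᵢ|²) = (1 + Σ|wᵢ|²)⁻² Σ hᵢⱼ dwᵢ ∧ dw̄ⱼ`, `hᵢⱼ = (1 + Σ|wᵢ|²)δᵢⱼ - w̄ᵢwⱼ`, and
`uᵗ (hᵢⱼ) ū = (u,u) + (w,w)(u,u) - |(w,u)|² > 0` by the Cauchy–Schwarz inequality. Also
(p. 118) `π^* ω_FS = (i/2π) ∂∂̄ log ‖z‖²` for the projection `π : ℂⁿ⁺¹ ∖ {0} → ℙⁿ`.
Griffiths–Harris (1978), pp. 30–31, give the same metric (`ω = (i/2π) ∂∂̄ log ‖Z‖²`).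

## The Lean proof

Mathlib's tangent space `TangentSpace 𝓘(ℝ, ℂⁿ) p` of `ℙⁿ(ℂ)` *is* the model `ℂⁿ`, read in the
frame of the preferred chart `chartAt p = stdChart (cidx p)`; a metric is a family of real bilinear
forms `g_p` on `ℂⁿ`, and its smoothness / the chart representative of a form are expressed through
the tangent coordinate changes, i.e. the derivatives of the transition maps `φⱼ ∘ φᵢ⁻¹`. We drop
the normalising constant `1/π` (irrelevant for being Kähler) and proceed as follows.

* **Upstairs** (`FubiniStudy.fsH`): on `ℂᵐ` with the Hermitian product `hdot a b = Σ conj(aₖ) bₖ`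
  and `nsq z = Σ ‖zₖ‖²`, the complex form `h_z(a, b) = ⟨a,b⟩/‖z‖² - ⟨a,z⟩⟨z,b⟩/‖z‖⁴` (the
  sesquilinear form of `π^* ω_FS`, Huybrechts p. 118) kills the radial direction and is invariant
  under `z ↦ cz`; hence `h_{μz}(μa + βz, μb + γz) = h_z(a, b)` (`fsH_rescale`).
* **Chart model** (`FubiniStudy.fsE`, `FubiniStudy.gE`): in the affine coordinate `y` of any
  chart, with the section `σᵢ(y) = (y₀, …, 1, …, y_{n-1})` and its derivative `L = liftL i`,
  `h_{σᵢ y}(L v, L w) = ⟨v,w⟩/(1+‖y‖²) - ⟨v,y⟩⟨y,w⟩/(1+‖y‖²)² =: fsE y v w` (Huybrechts' matrix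
  `(1+|w|²)⁻² hᵢⱼ`), independent of `i`; the metric is `gE y = Re fsE y` (a continuous real
  bilinear form), Hermitian (`gE_I_smul_I_smul`) and positive:
  `gE y v v ≥ ‖v‖²/(1+‖y‖²)²` by Cauchy–Schwarz (`le_gE_self`, Huybrechts' step (c)).
* **Gluing** (`FubiniStudy.fsE_transition`, Huybrechts' step (a)): for the transition
  `τ = φⱼ ∘ φᵢ⁻¹` one has `σⱼ ∘ τ = μ • σᵢ` with `μ = 1/(σᵢ y)ⱼ` near `y`, so by the chain and
  product rules `L_j (Dτ v) = μ L_i v + (Dμ v) σᵢ y`, and `fsH_rescale` gives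
  `fsE (τ y) (Dτ v) (Dτ w) = fsE y v w`, `Dτ = fderiv ℝ τ y`.
* **The metric** (`FubiniStudy.fubiniStudyMetric`): `g_p := gE (φ_{cidx p} p)`. Since the inverse
  tangent trivialization at `x₀` is `fderiv ℝ (φ_{cidx x} ∘ φ_{cidx x₀}⁻¹)`
  (`symmL_trivializationAt_eq`), the coordinate expression of the section `g` at `x₀` is exactly
  `y ↦ gE y` by gluing, which is `C^∞` (`contDiff_gE`); this is the smoothness field, via
  `contMDiffAt_section` and `Literature.Geometry.Kaehler.trivializationAt_bilinForm_apply₂`.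
* **Closedness** (Huybrechts' step (b), made real): the Kähler form `ω(v, w) = g(Jv, w)` has chart
  representative `Im fsE y` at every `x₀` (gluing again, `inChart_kaehlerForm_fubiniStudyMetric`),
  and `Im fsE = dβ` for the smooth `1`-form `β_y(w) = Im⟨y,w⟩ / (2(1+‖y‖²))` — the real form of
  `ω = (i/2)∂∂̄ log(1+‖y‖²) = d(-(i/2)∂ log(1+‖y‖²))` — by an explicit derivative computation
  (`extDeriv_fsPotForm_apply_eq`); so `mextDeriv ω = d(dβ) = 0` by Mathlib's `extDeriv_extDeriv`.

From `symmL_trivializationAt_eq` on, the real `C^∞` manifold structure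
`[IsManifold 𝓘(ℝ, ℂⁿ) ∞ ℙⁿ(ℂ)]` is a section hypothesis (Mathlib's tangent bundle needs it); the
discharge feeds it `isManifold_real_of_isManifold_complex` under the fact's own hypothesis
`h : isManifold_projectivization ℂ n` (itself the theorem `isManifold_projectivization_holds` of
`ProjectiveSpaceProofs.lean`), exactly as the fact installs them with `haveI`. No instance is
declared. The transition maps enter only through the elementary `fsE_transition`
(`contDiffOn_stdChartFun_comp_stdChartInv`), not through the abstract holomorphic structure.

## References

* [HuybrechtsCG2005] D. Huybrechts, *Complex Geometry. An Introduction*, Universitext, Springer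
  (2005), §3.1, Examples 3.1.9 i), pp. 117–118 (the Fubini–Study metric), Cor. 3.1.11.
* [GriffithsHarris1978] P. Griffiths, J. Harris, *Principles of Algebraic Geometry* (1978),
  pp. 30–31 (Fubini–Study metric on `ℙⁿ`), p. 109.
* C. Voisin, *Hodge Theory and Complex Algebraic Geometry I* (2002), §3.1, Ex. 3.10.
-/

noncomputable section

open scoped ComplexConjugate
open Complex

namespace Literature.AlgebraicGeometry.Motives

namespace FubiniStudy

variable {m : ℕ}

/-- The standard Hermitian product `⟨a, b⟩ = Σₖ conj(aₖ) bₖ` on `ℂᵐ` (conjugate-linear in the first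
variable, as Mathlib's `inner`; Huybrechts writes `( , )`). [folklore] -/
def hdot (a b : Fin m → ℂ) : ℂ := ∑ k, conj (a k) * b k

/-- The squared Euclidean norm `‖z‖² = Σₖ ‖zₖ‖²` on `ℂᵐ` (the model `Fin m → ℂ` itself carries the sup
norm). [folklore] -/
def nsq (z : Fin m → ℂ) : ℝ := ∑ k, ‖z k‖ ^ 2

/-- `⟨a + a', b⟩ = ⟨a, b⟩ + ⟨a', b⟩`. [folklore] -/
theorem hdot_add_left (a a' b : Fin m → ℂ) : hdot (a + a') b = hdot a b + hdot a' b := by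
  simp only [hdot, Pi.add_apply, map_add, add_mul, Finset.sum_add_distrib]

/-- `⟨a, b + b'⟩ = ⟨a, b⟩ + ⟨a, b'⟩`. [folklore] -/
theorem hdot_add_right (a b b' : Fin m → ℂ) : hdot a (b + b') = hdot a b + hdot a b' := by
  simp only [hdot, Pi.add_apply, mul_add, Finset.sum_add_distrib]

/-- `⟨c a, b⟩ = conj(c) ⟨a, b⟩`. [folklore] -/
theorem hdot_smul_left (c : ℂ) (a b : Fin m → ℂ) : hdot (c • a) b = conj c * hdot a b := by
  simp only [hdot, Pi.smul_apply, smul_eq_mul, map_mul, Finset.mul_sum, mul_assoc]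

/-- `⟨a, c b⟩ = c ⟨a, b⟩`. [folklore] -/
theorem hdot_smul_right (c : ℂ) (a b : Fin m → ℂ) : hdot a (c • b) = c * hdot a b := by
  simp only [hdot, Pi.smul_apply, smul_eq_mul, Finset.mul_sum]
  exact Finset.sum_congr rfl fun k _ ↦ by ring

/-- `⟨c a, b⟩ = c ⟨a, b⟩` for real `c`. [folklore] -/
theorem hdot_real_smul_left (c : ℝ) (a b : Fin m → ℂ) :
    hdot (c • a) b = (c : ℂ) * hdot a b := by
  rw [← Complex.coe_smul, hdot_smul_left, Complex.conj_ofReal]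

/-- `⟨a, c b⟩ = c ⟨a, b⟩` for real `c`. [folklore] -/
theorem hdot_real_smul_right (c : ℝ) (a b : Fin m → ℂ) :
    hdot a (c • b) = (c : ℂ) * hdot a b := by
  rw [← Complex.coe_smul, hdot_smul_right]

/-- Hermitian symmetry `conj ⟨a, b⟩ = ⟨b, a⟩`. [folklore] -/
theorem hdot_conj_symm (a b : Fin m → ℂ) : conj (hdot a b) = hdot b a := by
  simp only [hdot, map_sum, map_mul, Complex.conj_conj]
  exact Finset.sum_congr rfl fun k _ ↦ by ring

/-- `⟨0, b⟩ = 0`. [folklore] -/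
@[simp] theorem hdot_zero_left (b : Fin m → ℂ) : hdot 0 b = 0 := by simp [hdot]

/-- `⟨a, 0⟩ = 0`. [folklore] -/
@[simp] theorem hdot_zero_right (a : Fin m → ℂ) : hdot a 0 = 0 := by simp [hdot]

/-- `⟨-a, b⟩ = -⟨a, b⟩`. [folklore] -/
theorem hdot_neg_left (a b : Fin m → ℂ) : hdot (-a) b = -hdot a b := by
  simp [hdot, Finset.sum_neg_distrib]

/-- `⟨a, -b⟩ = -⟨a, b⟩`. [folklore] -/
theorem hdot_neg_right (a b : Fin m → ℂ) : hdot a (-b) = -hdot a b := by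
  simp [hdot, Finset.sum_neg_distrib]

/-- `⟨a - a', b⟩ = ⟨a, b⟩ - ⟨a', b⟩`. [folklore] -/
theorem hdot_sub_left (a a' b : Fin m → ℂ) : hdot (a - a') b = hdot a b - hdot a' b := by
  rw [sub_eq_add_neg, hdot_add_left, hdot_neg_left, sub_eq_add_neg]

/-- `⟨a, b - b'⟩ = ⟨a, b⟩ - ⟨a, b'⟩`. [folklore] -/
theorem hdot_sub_right (a b b' : Fin m → ℂ) : hdot a (b - b') = hdot a b - hdot a b' := by
  rw [sub_eq_add_neg, hdot_add_right, hdot_neg_right, sub_eq_add_neg]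

/-- `⟨z, z⟩ = ‖z‖²` (as a complex number). [folklore] -/
theorem hdot_self (z : Fin m → ℂ) : hdot z z = (nsq z : ℂ) := by
  simp only [hdot, nsq, Complex.ofReal_sum, Complex.ofReal_pow, ← Complex.normSq_eq_conj_mul_self,
    Complex.normSq_eq_norm_sq]

/-- `0 ≤ ‖z‖²`. [folklore] -/
theorem nsq_nonneg (z : Fin m → ℂ) : 0 ≤ nsq z :=
  Finset.sum_nonneg fun _ _ ↦ sq_nonneg _

/-- Each coordinate is bounded by the Euclidean norm: `‖zₖ‖² ≤ Σ ‖zⱼ‖²`. [folklore] -/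
theorem norm_sq_le_nsq (z : Fin m → ℂ) (k : Fin m) : ‖z k‖ ^ 2 ≤ nsq z :=
  Finset.single_le_sum (f := fun k ↦ ‖z k‖ ^ 2) (fun _ _ ↦ sq_nonneg _) (Finset.mem_univ k)

/-- The sup norm is bounded by the Euclidean norm: `‖z‖²_∞ ≤ Σ ‖zₖ‖²`. [folklore] -/
theorem norm_sq_le_nsq' (z : Fin m → ℂ) : ‖z‖ ^ 2 ≤ nsq z := by
  obtain h | h := (Nat.eq_zero_or_pos m)
  · subst h
    simp [nsq, Subsingleton.elim z 0]
  · haveI : Nonempty (Fin m) := ⟨⟨0, h⟩⟩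
    obtain ⟨k, -, hk⟩ :=
      Finset.exists_max_image Finset.univ (fun k ↦ ‖z k‖) Finset.univ_nonempty
    have hz : ‖z‖ = ‖z k‖ := by
      apply le_antisymm
      · exact (pi_norm_le_iff_of_nonneg (norm_nonneg _)).2 fun j ↦ hk j (Finset.mem_univ j)
      · exact norm_le_pi_norm z k
    rw [hz]
    exact norm_sq_le_nsq z k

/-- `‖z‖² > 0` for `z ≠ 0`. [folklore] -/
theorem nsq_pos {z : Fin m → ℂ} (hz : z ≠ 0) : 0 < nsq z := by
  obtain ⟨k, hk⟩ := Function.ne_iff.1 hz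
  exact lt_of_lt_of_le (by positivity) (norm_sq_le_nsq z k)

/-- `‖z‖² = 0 ↔ z = 0`. [folklore] -/
theorem nsq_eq_zero_iff {z : Fin m → ℂ} : nsq z = 0 ↔ z = 0 := by
  constructor
  · intro h
    by_contra hz
    exact (nsq_pos hz).ne' h
  · rintro rfl
    simp [nsq]

/-- `hdot` is the inner product of `EuclideanSpace ℂ (Fin m)` transported along `WithLp.toLp` (used
only to import the Cauchy–Schwarz inequality from Mathlib). [folklore] -/
theorem hdot_eq_inner (a b : Fin m → ℂ) :
    hdot a b = inner ℂ (WithLp.toLp 2 a : EuclideanSpace ℂ (Fin m)) (WithLp.toLp 2 b) := by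
  simp only [hdot, PiLp.inner_apply, RCLike.inner_apply']

/-- `nsq` is the squared norm of `EuclideanSpace ℂ (Fin m)` transported along `WithLp.toLp`.
[folklore] -/
theorem nsq_eq_norm_sq (a : Fin m → ℂ) :
    nsq a = ‖(WithLp.toLp 2 a : EuclideanSpace ℂ (Fin m))‖ ^ 2 := by
  rw [EuclideanSpace.norm_sq_eq]
  simp [nsq]

/-- **Cauchy–Schwarz** for the standard Hermitian product: `|⟨a, b⟩|² ≤ ‖a‖² ‖b‖²` (the inequality
invoked by Huybrechts, p. 118, for the positivity of `ω_FS`). [folklore] -/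
theorem normSq_hdot_le (a b : Fin m → ℂ) : Complex.normSq (hdot a b) ≤ nsq a * nsq b := by
  rw [Complex.normSq_eq_norm_sq, hdot_eq_inner, nsq_eq_norm_sq, nsq_eq_norm_sq,
    ← mul_pow]
  gcongr
  exact norm_inner_le_norm _ _

/-- The Fubini–Study form **upstairs** on `ℂᵐ ∖ {0}`: `h_z(a, b) = ⟨a,b⟩/‖z‖² - ⟨a,z⟩⟨z,b⟩/‖z‖⁴`, the
sesquilinear form of `π^* ω_FS = (i/2π) ∂∂̄ log ‖z‖²` (Huybrechts, p. 118; normalising constant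
dropped). Junk value `0` at `z = 0` (division by zero), never used.
[cite: HuybrechtsCG2005, §3.1 Examples 3.1.9 i) pp. 117–118] -/
def fsH (z a b : Fin m → ℂ) : ℂ :=
  hdot a b / (nsq z : ℂ) - hdot a z * hdot z b / (nsq z : ℂ) ^ 2

/-- `h_z` is Hermitian: `conj h_z(a, b) = h_z(b, a)`.
[cite: HuybrechtsCG2005, §3.1 Examples 3.1.9 i) pp. 117–118] -/
theorem fsH_conj_symm (z a b : Fin m → ℂ) : conj (fsH z a b) = fsH z b a := by
  simp only [fsH, map_sub, map_div₀, map_mul, map_pow, Complex.conj_ofReal, hdot_conj_symm]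
  ring

/-- `Re h_z` is symmetric. [cite: HuybrechtsCG2005, §3.1 Examples 3.1.9 i) pp. 117–118] -/
theorem fsH_re_symm (z a b : Fin m → ℂ) : (fsH z a b).re = (fsH z b a).re := by
  rw [← fsH_conj_symm, Complex.conj_re]

/-- `h_z` is additive in the first slot.
[cite: HuybrechtsCG2005, §3.1 Examples 3.1.9 i) pp. 117–118] -/
theorem fsH_add_left (z a a' b : Fin m → ℂ) : fsH z (a + a') b = fsH z a b + fsH z a' b := by
  simp only [fsH, hdot_add_left]
  ring

/-- `h_z` is additive in the second slot.
[cite: HuybrechtsCG2005, §3.1 Examples 3.1.9 i) pp. 117–118] -/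
theorem fsH_add_right (z a b b' : Fin m → ℂ) : fsH z a (b + b') = fsH z a b + fsH z a b' := by
  simp only [fsH, hdot_add_right]
  ring

/-- `h_z` is conjugate-linear in the first slot.
[cite: HuybrechtsCG2005, §3.1 Examples 3.1.9 i) pp. 117–118] -/
theorem fsH_smul_left (z : Fin m → ℂ) (c : ℂ) (a b : Fin m → ℂ) :
    fsH z (c • a) b = conj c * fsH z a b := by
  simp only [fsH, hdot_smul_left]
  ring

/-- `h_z` is linear in the second slot.
[cite: HuybrechtsCG2005, §3.1 Examples 3.1.9 i) pp. 117–118] -/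
theorem fsH_smul_right (z : Fin m → ℂ) (c : ℂ) (a b : Fin m → ℂ) :
    fsH z a (c • b) = c * fsH z a b := by
  simp only [fsH, hdot_smul_right]
  ring

/-- `h_z` kills the radial direction in the first slot: `h_z(z, b) = 0` (`π^* ω_FS` is degenerate
along the fibres of `π`). [cite: HuybrechtsCG2005, §3.1 Examples 3.1.9 i) pp. 117–118] -/
theorem fsH_self_left (z b : Fin m → ℂ) : fsH z z b = 0 := by
  simp only [fsH, hdot_self]
  rcases eq_or_ne (nsq z) 0 with h | h
  · simp [h]
  · have : (nsq z : ℂ) ≠ 0 := by exact_mod_cast h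
    field_simp
    ring

/-- `h_z` kills the radial direction in the second slot: `h_z(a, z) = 0`.
[cite: HuybrechtsCG2005, §3.1 Examples 3.1.9 i) pp. 117–118] -/
theorem fsH_self_right (z a : Fin m → ℂ) : fsH z a z = 0 := by
  simp only [fsH, hdot_self]
  rcases eq_or_ne (nsq z) 0 with h | h
  · simp [h]
  · have : (nsq z : ℂ) ≠ 0 := by exact_mod_cast h
    field_simp
    ring

/-- `‖c z‖² = |c|² ‖z‖²`. [folklore] -/
theorem nsq_smul (c : ℂ) (z : Fin m → ℂ) : nsq (c • z) = ‖c‖ ^ 2 * nsq z := by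
  simp only [nsq, Pi.smul_apply, smul_eq_mul, norm_mul, mul_pow, Finset.mul_sum]

/-- Scale invariance of the upstairs form: `h_{cz}(ca, cb) = h_z(a, b)` for `c ≠ 0` (`π^* ω_FS` is
`ℂˣ`-invariant). [cite: HuybrechtsCG2005, §3.1 Examples 3.1.9 i) pp. 117–118] -/
theorem fsH_smul_smul_smul {c : ℂ} (hc : c ≠ 0) (z a b : Fin m → ℂ) :
    fsH (c • z) (c • a) (c • b) = fsH z a b := by
  simp only [fsH, hdot_smul_left, hdot_smul_right, nsq_smul, Complex.ofReal_mul,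
    Complex.ofReal_pow]
  have hn : (‖c‖ : ℂ) ^ 2 = conj c * c := by
    rw [← Complex.normSq_eq_conj_mul_self, Complex.normSq_eq_norm_sq, Complex.ofReal_pow]
  rw [hn]
  have hc' : conj c ≠ 0 := (map_ne_zero _).2 hc
  rcases eq_or_ne (nsq z) 0 with h | h
  · simp [h]
  · have : (nsq z : ℂ) ≠ 0 := by exact_mod_cast h
    field_simp

/-- **Invariance under rescaled lifts**: `h_{μz}(μa + βz, μb + γz) = h_z(a, b)` for `μ ≠ 0` — the form
of `π^* ω_FS` descends to `ℙⁿ`, whatever local lift is used (combines `fsH_self_left/right` and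
`fsH_smul_smul_smul`). [cite: HuybrechtsCG2005, §3.1 Examples 3.1.9 i) pp. 117–118] -/
theorem fsH_rescale {μ : ℂ} (hμ : μ ≠ 0) (β γ : ℂ) (z a b : Fin m → ℂ) :
    fsH (μ • z) (μ • a + β • z) (μ • b + γ • z) = fsH z a b := by
  have hz : z = μ⁻¹ • (μ • z) := by rw [smul_smul, inv_mul_cancel₀ hμ, one_smul]
  have h1 : β • z = (β * μ⁻¹) • (μ • z) := by rw [← smul_smul, ← hz]
  have h2 : γ • z = (γ * μ⁻¹) • (μ • z) := by rw [← smul_smul, ← hz]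
  rw [h1, h2, fsH_add_left, fsH_add_right, fsH_add_right, fsH_smul_left _ (β * μ⁻¹),
    fsH_smul_left _ (β * μ⁻¹), fsH_smul_right _ (γ * μ⁻¹), fsH_smul_right _ (γ * μ⁻¹),
    fsH_self_left, fsH_self_right, fsH_self_right, fsH_smul_smul_smul hμ]
  ring

/-- `h_z(i a, b) = -i h_z(a, b)`. [cite: HuybrechtsCG2005, §3.1 Examples 3.1.9 i) pp. 117–118] -/
theorem fsH_I_smul_left (z a b : Fin m → ℂ) : fsH z (I • a) b = -I * fsH z a b := by
  rw [fsH_smul_left, Complex.conj_I]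

/-- `h_z(i a, i b) = h_z(a, b)` (`Re h_z` is Hermitian in the sense of
`Bundle.RiemannianMetric.IsHermitian`).
[cite: HuybrechtsCG2005, §3.1 Examples 3.1.9 i) pp. 117–118] -/
theorem fsH_I_smul_I_smul (z a b : Fin m → ℂ) : fsH z (I • a) (I • b) = fsH z a b := by
  rw [fsH_smul_left, fsH_smul_right, Complex.conj_I]
  ring_nf
  rw [Complex.I_sq]
  ring

/-- `Re h_z(i a, b) = Im h_z(a, b)`: the Kähler form `g(J·, ·)` of `g = Re h` is `Im h`.
[cite: HuybrechtsCG2005, §3.1 Examples 3.1.9 i) pp. 117–118] -/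
theorem re_fsH_I_smul_left (z a b : Fin m → ℂ) : (fsH z (I • a) b).re = (fsH z a b).im := by
  rw [fsH_I_smul_left]
  simp

/-- Explicit real part of `h_z`. [cite: HuybrechtsCG2005, §3.1 Examples 3.1.9 i) pp. 117–118] -/
theorem fsH_re (z a b : Fin m → ℂ) :
    (fsH z a b).re = (hdot a b).re / nsq z - (hdot a z * hdot z b).re / (nsq z) ^ 2 := by
  simp only [fsH, Complex.sub_re, ← Complex.ofReal_pow, Complex.div_ofReal_re]

/-- Explicit imaginary part of `h_z`.
[cite: HuybrechtsCG2005, §3.1 Examples 3.1.9 i) pp. 117–118] -/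
theorem fsH_im (z a b : Fin m → ℂ) :
    (fsH z a b).im = (hdot a b).im / nsq z - (hdot a z * hdot z b).im / (nsq z) ^ 2 := by
  simp only [fsH, Complex.sub_im, ← Complex.ofReal_pow, Complex.div_ofReal_im]

/-- `h_z(a, a)` is real, `= ‖a‖²/‖z‖² - |⟨z,a⟩|²/‖z‖⁴`.
[cite: HuybrechtsCG2005, §3.1 Examples 3.1.9 i) pp. 117–118] -/
theorem fsH_self_re (z a : Fin m → ℂ) :
    (fsH z a a).re = nsq a / nsq z - Complex.normSq (hdot z a) / (nsq z) ^ 2 := by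
  rw [fsH_re, hdot_self, Complex.ofReal_re, ← hdot_conj_symm z a,
    ← Complex.normSq_eq_conj_mul_self, Complex.ofReal_re]


/-! ### The chart model on `ℂⁿ` -/

variable {n : ℕ}

/-- The linear lift `L_i : v ↦ (v₀, …, 0, …, v_{n-1})` (a `0` inserted in position `i`), as a
continuous `ℂ`-linear map `ℂⁿ → ℂⁿ⁺¹`: the derivative of the affine section `σᵢ : y ↦ (y₀, …, 1,
…, y_{n-1})` of the projection over the chart `Uᵢ` (`stdChartInv i y = [σᵢ y]`). [folklore] -/
def liftL (i : Fin (n + 1)) : (Fin n → ℂ) →L[ℂ] (Fin (n + 1) → ℂ) :=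
  LinearMap.toContinuousLinearMap
    { toFun := fun v ↦ (Fin.insertNth i (0 : ℂ) v : Fin (n + 1) → ℂ)
      map_add' := fun v w ↦ by
        ext m
        refine Fin.succAboveCases i ?_ (fun k ↦ ?_) m <;> simp
      map_smul' := fun c v ↦ by
        ext m
        refine Fin.succAboveCases i ?_ (fun k ↦ ?_) m <;> simp }

/-- `L_i v = Fin.insertNth i 0 v`. [folklore] -/
@[simp]
theorem liftL_apply (i : Fin (n + 1)) (v : Fin n → ℂ) :
    liftL i v = (Fin.insertNth i (0 : ℂ) v : Fin (n + 1) → ℂ) :=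
  rfl

/-- The section is affine: `σᵢ y = σᵢ 0 + L_i y`. [folklore] -/
theorem insertNth_one_eq (i : Fin (n + 1)) (y : Fin n → ℂ) :
    (Fin.insertNth i (1 : ℂ) y : Fin (n + 1) → ℂ) =
      (Fin.insertNth i (1 : ℂ) (0 : Fin n → ℂ) : Fin (n + 1) → ℂ) + liftL i y := by
  ext m
  refine Fin.succAboveCases i ?_ (fun k ↦ ?_) m <;> simp

/-- The section `σᵢ` has derivative `L_i` everywhere. [folklore] -/
theorem hasFDerivAt_insertNth_one (i : Fin (n + 1)) (y : Fin n → ℂ) :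
    HasFDerivAt (fun y : Fin n → ℂ ↦ (Fin.insertNth i (1 : ℂ) y : Fin (n + 1) → ℂ))
      (liftL i) y := by
  have : (fun y : Fin n → ℂ ↦ (Fin.insertNth i (1 : ℂ) y : Fin (n + 1) → ℂ)) =
      fun y ↦ (Fin.insertNth i (1 : ℂ) (0 : Fin n → ℂ) : Fin (n + 1) → ℂ) + liftL i y :=
    funext (insertNth_one_eq i)
  rw [this]
  exact ((liftL i).hasFDerivAt).const_add _

/-- `⟨insertNth i a v, insertNth i b w⟩ = conj(a) b + ⟨v, w⟩`. [folklore] -/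
theorem hdot_insertNth (i : Fin (n + 1)) (a b : ℂ) (v w : Fin n → ℂ) :
    hdot (Fin.insertNth i a v : Fin (n + 1) → ℂ) (Fin.insertNth i b w : Fin (n + 1) → ℂ) =
      conj a * b + hdot v w := by
  simp only [hdot, Fin.sum_univ_succAbove _ i, Fin.insertNth_apply_same,
    Fin.insertNth_apply_succAbove]

/-- `‖insertNth i a v‖² = |a|² + ‖v‖²`. [folklore] -/
theorem nsq_insertNth (i : Fin (n + 1)) (a : ℂ) (v : Fin n → ℂ) :
    nsq (Fin.insertNth i a v : Fin (n + 1) → ℂ) = ‖a‖ ^ 2 + nsq v := by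
  simp only [nsq, Fin.sum_univ_succAbove _ i, Fin.insertNth_apply_same,
    Fin.insertNth_apply_succAbove]

/-- `⟨L_i v, L_i w⟩ = ⟨v, w⟩`. [folklore] -/
@[simp] theorem hdot_liftL_liftL (i : Fin (n + 1)) (v w : Fin n → ℂ) :
    hdot (liftL i v) (liftL i w) = hdot v w := by
  simp [hdot_insertNth]

/-- `⟨L_i v, σᵢ y⟩ = ⟨v, y⟩`. [folklore] -/
@[simp] theorem hdot_liftL_insertNth_one (i : Fin (n + 1)) (v y : Fin n → ℂ) :
    hdot (liftL i v) (Fin.insertNth i (1 : ℂ) y : Fin (n + 1) → ℂ) = hdot v y := by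
  simp [hdot_insertNth]

/-- `⟨σᵢ y, L_i w⟩ = ⟨y, w⟩`. [folklore] -/
@[simp] theorem hdot_insertNth_one_liftL (i : Fin (n + 1)) (y w : Fin n → ℂ) :
    hdot (Fin.insertNth i (1 : ℂ) y : Fin (n + 1) → ℂ) (liftL i w) = hdot y w := by
  simp [hdot_insertNth]

/-- `‖L_i v‖² = ‖v‖²`. [folklore] -/
@[simp] theorem nsq_liftL (i : Fin (n + 1)) (v : Fin n → ℂ) : nsq (liftL i v) = nsq v := by
  simp [nsq_insertNth]

/-- `‖σᵢ y‖² = 1 + ‖y‖²`. [folklore] -/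
@[simp] theorem nsq_insertNth_one (i : Fin (n + 1)) (y : Fin n → ℂ) :
    nsq (Fin.insertNth i (1 : ℂ) y : Fin (n + 1) → ℂ) = 1 + nsq y := by
  simp [nsq_insertNth]

/-- `0 < 1 + ‖y‖²`. [folklore] -/
theorem one_add_nsq_pos (y : Fin n → ℂ) : 0 < 1 + nsq y :=
  add_pos_of_pos_of_nonneg one_pos (nsq_nonneg y)

/-- The Fubini–Study form in an affine chart: `h_y(v, w) = ⟨v,w⟩/(1+‖y‖²) - ⟨v,y⟩⟨y,w⟩/(1+‖y‖²)²`,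
i.e. Huybrechts' `(1 + Σ|wᵢ|²)⁻² Σ hᵢⱼ`, `hᵢⱼ = (1 + Σ|wᵢ|²)δᵢⱼ - w̄ᵢwⱼ` (p. 118), as a
sesquilinear form (normalising constant dropped). It is `fsH` at the lift `σᵢ y` on lifted vectors
(`fsH_insertNth_one`), for every `i`. [cite: HuybrechtsCG2005, §3.1 Examples 3.1.9 i) pp. 117–118] -/
def fsE (y v w : Fin n → ℂ) : ℂ :=
  hdot v w / ((1 + nsq y : ℝ) : ℂ) - hdot v y * hdot y w / ((1 + nsq y : ℝ) : ℂ) ^ 2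

/-- `h_{σᵢ y}(L_i v, L_i w) = fsE y v w`: the chart form is the upstairs form read through the section
`σᵢ` — independently of the chart index `i`.
[cite: HuybrechtsCG2005, §3.1 Examples 3.1.9 i) pp. 117–118] -/
theorem fsH_insertNth_one (i : Fin (n + 1)) (y v w : Fin n → ℂ) :
    fsH (Fin.insertNth i (1 : ℂ) y : Fin (n + 1) → ℂ) (liftL i v) (liftL i w) = fsE y v w := by
  simp only [fsH, fsE, hdot_liftL_liftL, hdot_liftL_insertNth_one, hdot_insertNth_one_liftL,
    nsq_insertNth_one]

/-- Explicit real part of the chart form (the Fubini–Study *metric* in coordinates).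
[cite: HuybrechtsCG2005, §3.1 Examples 3.1.9 i) pp. 117–118] -/
theorem fsE_re (y v w : Fin n → ℂ) :
    (fsE y v w).re =
      (hdot v w).re / (1 + nsq y) - (hdot v y * hdot y w).re / (1 + nsq y) ^ 2 := by
  simp only [fsE, Complex.sub_re, ← Complex.ofReal_pow, Complex.div_ofReal_re]

/-- Explicit imaginary part of the chart form (the Fubini–Study *Kähler form* in coordinates).
[cite: HuybrechtsCG2005, §3.1 Examples 3.1.9 i) pp. 117–118] -/
theorem fsE_im (y v w : Fin n → ℂ) :
    (fsE y v w).im =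
      (hdot v w).im / (1 + nsq y) - (hdot v y * hdot y w).im / (1 + nsq y) ^ 2 := by
  simp only [fsE, Complex.sub_im, ← Complex.ofReal_pow, Complex.div_ofReal_im]

/-- The chart form is Hermitian: `conj h_y(v, w) = h_y(w, v)`.
[cite: HuybrechtsCG2005, §3.1 Examples 3.1.9 i) pp. 117–118] -/
theorem fsE_conj_symm (y v w : Fin n → ℂ) : conj (fsE y v w) = fsE y w v := by
  simp only [fsE, map_sub, map_div₀, map_mul, map_pow, Complex.conj_ofReal, hdot_conj_symm]
  ring

/-- The chart form is additive in the first slot.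
[cite: HuybrechtsCG2005, §3.1 Examples 3.1.9 i) pp. 117–118] -/
theorem fsE_add_left (y v v' w : Fin n → ℂ) : fsE y (v + v') w = fsE y v w + fsE y v' w := by
  simp only [fsE, hdot_add_left]
  ring

/-- The chart form is real-homogeneous in the first slot.
[cite: HuybrechtsCG2005, §3.1 Examples 3.1.9 i) pp. 117–118] -/
theorem fsE_real_smul_left (y : Fin n → ℂ) (c : ℝ) (v w : Fin n → ℂ) :
    fsE y (c • v) w = (c : ℂ) * fsE y v w := by
  simp only [fsE, hdot_real_smul_left]
  ring

/-- `h_y(i v, w) = -i h_y(v, w)`. [cite: HuybrechtsCG2005, §3.1 Examples 3.1.9 i) pp. 117–118] -/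
theorem fsE_I_smul_left (y v w : Fin n → ℂ) : fsE y (I • v) w = -I * fsE y v w := by
  simp only [fsE, hdot_smul_left, Complex.conj_I]
  ring

/-- `h_y(i v, i w) = h_y(v, w)`. [cite: HuybrechtsCG2005, §3.1 Examples 3.1.9 i) pp. 117–118] -/
theorem fsE_I_smul_I_smul (y v w : Fin n → ℂ) : fsE y (I • v) (I • w) = fsE y v w := by
  simp only [fsE, hdot_smul_left, hdot_smul_right, Complex.conj_I]
  ring_nf
  rw [Complex.I_sq]
  ring

/-- `Re h_y` is symmetric. [cite: HuybrechtsCG2005, §3.1 Examples 3.1.9 i) pp. 117–118] -/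
theorem re_fsE_symm (y v w : Fin n → ℂ) : (fsE y v w).re = (fsE y w v).re := by
  rw [← fsE_conj_symm, Complex.conj_re]

/-- `Im h_y` is antisymmetric. [cite: HuybrechtsCG2005, §3.1 Examples 3.1.9 i) pp. 117–118] -/
theorem im_fsE_symm (y v w : Fin n → ℂ) : (fsE y v w).im = -(fsE y w v).im := by
  rw [← fsE_conj_symm, Complex.conj_im]

/-- `Re h_y(i v, w) = Im h_y(v, w)`: the Kähler form of `g = Re h_y` is `Im h_y`.
[cite: HuybrechtsCG2005, §3.1 Examples 3.1.9 i) pp. 117–118] -/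
theorem re_fsE_I_smul_left (y v w : Fin n → ℂ) : (fsE y (I • v) w).re = (fsE y v w).im := by
  rw [fsE_I_smul_left]
  simp

/-- `h_y(v, v) = ‖v‖²/(1+‖y‖²) - |⟨y,v⟩|²/(1+‖y‖²)²` (real).
[cite: HuybrechtsCG2005, §3.1 Examples 3.1.9 i) pp. 117–118] -/
theorem fsE_self_re (y v : Fin n → ℂ) :
    (fsE y v v).re = nsq v / (1 + nsq y) - Complex.normSq (hdot y v) / (1 + nsq y) ^ 2 := by
  rw [fsE_re, hdot_self, Complex.ofReal_re, ← hdot_conj_symm y v,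
    ← Complex.normSq_eq_conj_mul_self, Complex.ofReal_re]

/-- **Positivity of the Fubini–Study metric** (Huybrechts' step `uᵗ(hᵢⱼ)ū = (u,u) + (w,w)(u,u) -
|(w,u)|² > 0`, p. 118, by Cauchy–Schwarz), in the quantitative form `Re h_y(v, v) ≥
‖v‖²/(1+‖y‖²)²`. [cite: HuybrechtsCG2005, §3.1 Examples 3.1.9 i) pp. 117–118] -/
theorem le_fsE_self_re (y v : Fin n → ℂ) : nsq v / (1 + nsq y) ^ 2 ≤ (fsE y v v).re := by
  rw [fsE_self_re]
  have hN := one_add_nsq_pos y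
  have hcs := normSq_hdot_le y v
  have key : nsq v / (1 + nsq y) - Complex.normSq (hdot y v) / (1 + nsq y) ^ 2 -
      nsq v / (1 + nsq y) ^ 2 =
        (nsq v * nsq y - Complex.normSq (hdot y v)) / (1 + nsq y) ^ 2 := by
    field_simp
    ring
  have : 0 ≤ (nsq v * nsq y - Complex.normSq (hdot y v)) / (1 + nsq y) ^ 2 :=
    div_nonneg (by nlinarith) (by positivity)
  linarith

/-- The Fubini–Study metric in an affine chart as a continuous real bilinear form on `ℂⁿ`: `g_y(v, w)
= Re h_y(v, w)` (built with `LinearMap.mk₂` and finite-dimensionality).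
[cite: HuybrechtsCG2005, §3.1 Examples 3.1.9 i) pp. 117–118] -/
def gE (y : Fin n → ℂ) : (Fin n → ℂ) →L[ℝ] (Fin n → ℂ) →L[ℝ] ℝ :=
  LinearMap.toContinuousLinearMap
    ((LinearMap.toContinuousLinearMap :
        ((Fin n → ℂ) →ₗ[ℝ] ℝ) ≃ₗ[ℝ] ((Fin n → ℂ) →L[ℝ] ℝ)).toLinearMap ∘ₗ
      LinearMap.mk₂ ℝ (fun v w ↦ (fsE y v w).re)
        (fun v v' w ↦ by rw [fsE_add_left, Complex.add_re])
        (fun c v w ↦ by rw [fsE_real_smul_left, Complex.re_ofReal_mul, smul_eq_mul])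
        (fun v w w' ↦ by rw [re_fsE_symm, fsE_add_left, Complex.add_re, re_fsE_symm y w,
          re_fsE_symm y w'])
        (fun c v w ↦ by
          rw [re_fsE_symm, fsE_real_smul_left, Complex.re_ofReal_mul, smul_eq_mul, re_fsE_symm]))

/-- `g_y(v, w) = Re h_y(v, w)`. [cite: HuybrechtsCG2005, §3.1 Examples 3.1.9 i) pp. 117–118] -/
@[simp]
theorem gE_apply (y v w : Fin n → ℂ) : gE y v w = (fsE y v w).re :=
  rfl

/-- `g_y` is symmetric. [cite: HuybrechtsCG2005, §3.1 Examples 3.1.9 i) pp. 117–118] -/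
theorem gE_symm (y v w : Fin n → ℂ) : gE y v w = gE y w v := by
  rw [gE_apply, gE_apply, re_fsE_symm]

/-- `g_y` is `J`-invariant: `g_y(i v, i w) = g_y(v, w)`.
[cite: HuybrechtsCG2005, §3.1 Examples 3.1.9 i) pp. 117–118] -/
theorem gE_I_smul_I_smul (y v w : Fin n → ℂ) : gE y (I • v) (I • w) = gE y v w := by
  rw [gE_apply, gE_apply, fsE_I_smul_I_smul]

/-- `g_y(v, v) ≥ ‖v‖²/(1+‖y‖²)²`. [cite: HuybrechtsCG2005, §3.1 Examples 3.1.9 i) pp. 117–118] -/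
theorem le_gE_self (y v : Fin n → ℂ) : nsq v / (1 + nsq y) ^ 2 ≤ gE y v v :=
  le_fsE_self_re y v

/-- `g_y` is positive definite (Huybrechts, p. 118).
[cite: HuybrechtsCG2005, §3.1 Examples 3.1.9 i) pp. 117–118] -/
theorem gE_self_pos (y : Fin n → ℂ) {v : Fin n → ℂ} (hv : v ≠ 0) : 0 < gE y v v :=
  lt_of_lt_of_le (div_pos (nsq_pos hv) (pow_pos (one_add_nsq_pos y) 2)) (le_gE_self y v)

/-- The unit ball of `g_y` is bounded: `g_y(v, v) < 1 → ‖v‖ < 1 + ‖y‖²` (von Neumann boundedness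
required by `Bundle.ContMDiffRiemannianMetric`).
[cite: HuybrechtsCG2005, §3.1 Examples 3.1.9 i) pp. 117–118] -/
theorem norm_sq_le_of_gE_self_lt_one (y : Fin n → ℂ) {v : Fin n → ℂ} (hv : gE y v v < 1) :
    ‖v‖ < 1 + nsq y := by
  have hN := one_add_nsq_pos y
  have h1 : nsq v < (1 + nsq y) ^ 2 := by
    have := lt_of_le_of_lt (le_gE_self y v) hv
    rwa [div_lt_one (by positivity)] at this
  have h2 : ‖v‖ ^ 2 < (1 + nsq y) ^ 2 := lt_of_le_of_lt (norm_sq_le_nsq' v) h1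
  exact lt_of_pow_lt_pow_left₀ 2 hN.le h2


/-! ### Invariance under the transition maps of `ℙⁿ(ℂ)` -/

open Projectivization Set _root_.Filter _root_.Topology

/-- On `φᵢ(Uᵢ ∩ Uⱼ)`, the lift of the transition map `φⱼ ∘ φᵢ⁻¹` is a rescaling of the lift: `σⱼ(φⱼ
φᵢ⁻¹ y) = (σᵢ y)ⱼ⁻¹ • σᵢ y` (Huybrechts, §2.1 p. 56: `φᵢⱼ(w) = (w₁/wᵢ, …)`).
[cite: HuybrechtsCG2005, §2.1 pp. 56–57] -/
theorem insertNth_one_transition (i j : Fin (n + 1)) {y : Fin n → ℂ}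
    (hy : (Fin.insertNth i (1 : ℂ) y : Fin (n + 1) → ℂ) j ≠ 0) :
    (Fin.insertNth j (1 : ℂ) (stdChartFun j (stdChartInv i y)) : Fin (n + 1) → ℂ) =
      ((Fin.insertNth i (1 : ℂ) y : Fin (n + 1) → ℂ) j)⁻¹ •
        (Fin.insertNth i (1 : ℂ) y : Fin (n + 1) → ℂ) := by
  have hτ : stdChartFun j (stdChartInv i y) = fun k ↦
      (Fin.insertNth i (1 : ℂ) y : Fin (n + 1) → ℂ) (j.succAbove k) /
        (Fin.insertNth i (1 : ℂ) y : Fin (n + 1) → ℂ) j :=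
    congrFun (stdChartFun_comp_stdChartInv (𝕜 := ℂ) i j) y
  rw [hτ]
  ext m
  refine Fin.succAboveCases j ?_ (fun k ↦ ?_) m
  · simp [inv_mul_cancel₀ hy]
  · simp only [Fin.insertNth_apply_succAbove, Pi.smul_apply, smul_eq_mul]
    ring

/-- `φᵢ(Uᵢ ∩ Uⱼ) = {y | (σᵢ y)ⱼ ≠ 0}` is open. [cite: HuybrechtsCG2005, §2.1 pp. 56–57] -/
theorem isOpen_setOf_insertNth_one_ne (i j : Fin (n + 1)) :
    IsOpen {y : Fin n → ℂ | (Fin.insertNth i (1 : ℂ) y : Fin (n + 1) → ℂ) j ≠ 0} :=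
  isOpen_ne_fun (contDiff_insertNth_one_apply (𝕜 := ℂ) i j).continuous continuous_const

/-- **The Fubini–Study metric glues** (Huybrechts' step `ωᵢ|_{Uᵢ ∩ Uⱼ} = ωⱼ|_{Uᵢ ∩ Uⱼ}`, p. 117), in
the form needed for Mathlib's chart-based tangent bundle: `h_{φⱼφᵢ⁻¹ y}(D v, D w) = h_y(v, w)`
with `D = fderiv ℝ (φⱼ ∘ φᵢ⁻¹) y` the (real) derivative of the transition map at `y ∈ φᵢ(Uᵢ ∩
Uⱼ)`. Proof: `σⱼ ∘ (φⱼφᵢ⁻¹) = μ • σᵢ` near `y` with `μ = 1/(σᵢ ·)ⱼ`, so `L_j ∘ D = μ L_i + Dμ ⊗ σᵢ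
y` (chain and product rules over `ℂ`, uniqueness of the derivative, restriction of scalars), and
`fsH_rescale`. [cite: HuybrechtsCG2005, §3.1 Examples 3.1.9 i) pp. 117–118] -/
theorem fsE_transition (i j : Fin (n + 1)) {y : Fin n → ℂ}
    (hy : (Fin.insertNth i (1 : ℂ) y : Fin (n + 1) → ℂ) j ≠ 0) (v w : Fin n → ℂ) :
    fsE (stdChartFun j (stdChartInv i y))
      (fderiv ℝ (stdChartFun j ∘ stdChartInv i : (Fin n → ℂ) → Fin n → ℂ) y v)
      (fderiv ℝ (stdChartFun j ∘ stdChartInv i : (Fin n → ℂ) → Fin n → ℂ) y w) = fsE y v w := by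
  set τ : (Fin n → ℂ) → Fin n → ℂ := stdChartFun j ∘ stdChartInv i with hτdef
  set U : Set (Fin n → ℂ) := {y' | (Fin.insertNth i (1 : ℂ) y' : Fin (n + 1) → ℂ) j ≠ 0} with hU
  have hUo : IsOpen U := isOpen_setOf_insertNth_one_ne i j
  have hyU : y ∈ U := hy
  -- derivatives over `ℂ`
  have hτd : DifferentiableAt ℂ τ y :=
    ((contDiffOn_stdChartFun_comp_stdChartInv (𝕜 := ℂ) i j).differentiableOn
      (by simp)).differentiableAt (hUo.mem_nhds hyU)
  have hτ : HasFDerivAt τ (fderiv ℂ τ y) y := hτd.hasFDerivAt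
  have h1 : HasFDerivAt (fun y' ↦ (Fin.insertNth j (1 : ℂ) (τ y') : Fin (n + 1) → ℂ))
      ((liftL j).comp (fderiv ℂ τ y)) y :=
    (hasFDerivAt_insertNth_one j (τ y)).comp y hτ
  have hcoord : HasFDerivAt
      (fun y' : Fin n → ℂ ↦ (Fin.insertNth i (1 : ℂ) y' : Fin (n + 1) → ℂ) j)
      ((ContinuousLinearMap.proj (R := ℂ) j).comp (liftL i)) y :=
    ((ContinuousLinearMap.proj (R := ℂ) (φ := fun _ : Fin (n + 1) ↦ ℂ) j).hasFDerivAt).comp y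
      (hasFDerivAt_insertNth_one i y)
  have hμ := (hasFDerivAt_inv hy).comp y hcoord
  have h2 := hμ.smul (hasFDerivAt_insertNth_one i y)
  -- the two lifts agree near `y`
  have heq : (fun y' ↦ ((Fin.insertNth i (1 : ℂ) y' : Fin (n + 1) → ℂ) j)⁻¹ •
      (Fin.insertNth i (1 : ℂ) y' : Fin (n + 1) → ℂ)) =ᶠ[𝓝 y]
      (fun y' ↦ (Fin.insertNth j (1 : ℂ) (τ y') : Fin (n + 1) → ℂ)) :=
    Filter.eventuallyEq_of_mem (hUo.mem_nhds hyU) fun y' hy' ↦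
      (insertNth_one_transition i j hy').symm
  have hD := (h2.congr_of_eventuallyEq heq.symm).unique h1
  -- pass to the real derivative
  have hR : fderiv ℝ τ y = (fderiv ℂ τ y).restrictScalars ℝ := (hτ.restrictScalars ℝ).fderiv
  rw [hR]
  simp only [ContinuousLinearMap.coe_restrictScalars']
  have key : ∀ u : Fin n → ℂ, liftL j (fderiv ℂ τ y u) =
      ((Fin.insertNth i (1 : ℂ) y : Fin (n + 1) → ℂ) j)⁻¹ • liftL i u +
        ((ContinuousLinearMap.toSpanSingleton ℂ
          (-((Fin.insertNth i (1 : ℂ) y : Fin (n + 1) → ℂ) j ^ 2)⁻¹)).comp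
          ((ContinuousLinearMap.proj (R := ℂ) j).comp (liftL i))) u •
          (Fin.insertNth i (1 : ℂ) y : Fin (n + 1) → ℂ) := by
    intro u
    have := DFunLike.congr_fun hD u
    simpa only [ContinuousLinearMap.comp_apply, add_apply, smul_apply,
      ContinuousLinearMap.smulRight_apply, Function.comp_apply] using this.symm
  rw [← fsH_insertNth_one j, ← fsH_insertNth_one i, insertNth_one_transition i j hy, key v,
    key w]
  exact fsH_rescale (inv_ne_zero hy) _ _ _ (liftL i v) (liftL i w)


/-! ### Calculus in the chart: smoothness, and the Kähler form is exact -/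

section Calculus

variable {m : ℕ}

/-- The Hermitian product as a continuous real-bilinear map `ℂᵐ × ℂᵐ → ℂ` (for the calculus of `y ↦ ⟨f
y, g y⟩`). [folklore] -/
def hdotB : (Fin m → ℂ) →L[ℝ] (Fin m → ℂ) →L[ℝ] ℂ :=
  LinearMap.toContinuousLinearMap
    ((LinearMap.toContinuousLinearMap :
        ((Fin m → ℂ) →ₗ[ℝ] ℂ) ≃ₗ[ℝ] ((Fin m → ℂ) →L[ℝ] ℂ)).toLinearMap ∘ₗ
      LinearMap.mk₂ ℝ (fun a b ↦ hdot a b) hdot_add_left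
        (fun c a b ↦ by rw [hdot_real_smul_left, Complex.real_smul])
        hdot_add_right
        (fun c a b ↦ by rw [hdot_real_smul_right, Complex.real_smul]))

/-- `hdotB a b = ⟨a, b⟩`. [folklore] -/
@[simp]
theorem hdotB_apply (a b : Fin m → ℂ) : hdotB a b = hdot a b :=
  rfl

/-- `a ↦ ⟨a, b⟩` is real-smooth (it is real-linear). [folklore] -/
theorem contDiff_hdot_left {k : WithTop ℕ∞} (b : Fin m → ℂ) :
    ContDiff ℝ k fun a : Fin m → ℂ ↦ hdot a b :=
  (hdotB.flip b).contDiff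

/-- `b ↦ ⟨a, b⟩` is smooth (it is linear). [folklore] -/
theorem contDiff_hdot_right {k : WithTop ℕ∞} (a : Fin m → ℂ) :
    ContDiff ℝ k fun b : Fin m → ℂ ↦ hdot a b :=
  (hdotB a).contDiff

/-- `‖y‖² = Re ⟨y, y⟩`. [folklore] -/
theorem nsq_eq_re_hdot (y : Fin m → ℂ) : nsq y = (hdot y y).re := by
  rw [hdot_self, Complex.ofReal_re]

/-- `y ↦ ‖y‖²` is smooth. [folklore] -/
theorem contDiff_nsq {k : WithTop ℕ∞} : ContDiff ℝ k (nsq : (Fin m → ℂ) → ℝ) := by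
  have h : (nsq : (Fin m → ℂ) → ℝ) = fun y ↦ (hdotB y y).re := funext fun y ↦ nsq_eq_re_hdot y
  rw [h]
  exact Complex.reCLM.contDiff.comp (hdotB.contDiff.clm_apply contDiff_id)

/-- `D(‖·‖²)(y) v = 2 Re ⟨y, v⟩`. [folklore] -/
theorem hasFDerivAt_nsq (y : Fin m → ℂ) :
    HasFDerivAt (nsq : (Fin m → ℂ) → ℝ) ((2 : ℝ) • Complex.reCLM.comp (hdotB y)) y := by
  have h : (nsq : (Fin m → ℂ) → ℝ) = fun y ↦ (hdotB y y).re := funext fun y ↦ nsq_eq_re_hdot y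
  rw [h]
  have h0 : HasFDerivAt (fun x : Fin m → ℂ ↦ (x, x))
      ((ContinuousLinearMap.id ℝ _).prod (ContinuousLinearMap.id ℝ _)) y :=
    (hasFDerivAt_id y).prodMk (hasFDerivAt_id y)
  have h1 : HasFDerivAt (fun y : Fin m → ℂ ↦ hdotB y y)
      ((hdotB.isBoundedBilinearMap.deriv (y, y)).comp
        ((ContinuousLinearMap.id ℝ _).prod (ContinuousLinearMap.id ℝ _))) y :=
    HasFDerivAt.comp (f := fun x : Fin m → ℂ ↦ (x, x)) y
      (hdotB.isBoundedBilinearMap.hasFDerivAt (y, y)) h0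
  refine (Complex.reCLM.hasFDerivAt.comp y h1).congr_fderiv ?_
  ext u
  simp only [ContinuousLinearMap.comp_apply, ContinuousLinearMap.prod_apply,
    ContinuousLinearMap.id_apply, IsBoundedBilinearMap.deriv_apply, hdotB_apply,
    Complex.reCLM_apply, Complex.add_re, smul_apply, smul_eq_mul]
  rw [← hdot_conj_symm y u, Complex.conj_re]
  ring

variable {n : ℕ}

/-- The potential of the Fubini–Study form in an affine chart, `β_y(w) = Im⟨y, w⟩ / (2(1 + ‖y‖²))`:
the real `1`-form `β = -(i/2)(∂ - ∂̄)… = Im(∂̄ log(1+‖y‖²))/2`-type primitive with `dβ = Im h_y`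
(`extDeriv_fsPotForm_apply_eq`), the real shadow of `ω = (i/2) ∂∂̄ log(1 + ‖y‖²) = d(-(i/2) ∂
log(1 + ‖y‖²))` (Huybrechts, p. 117: `ωᵢ = (i/2π)∂∂̄ log(Σ|w_k|² + 1)`).
[cite: HuybrechtsCG2005, §3.1 Examples 3.1.9 i) pp. 117–118] -/
def fsPot (y w : Fin n → ℂ) : ℝ := (hdot y w).im / (2 * (1 + nsq y))

/-- `β_y` as a continuous real linear form on `ℂⁿ`.
[cite: HuybrechtsCG2005, §3.1 Examples 3.1.9 i) pp. 117–118] -/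
def fsPotL (y : Fin n → ℂ) : (Fin n → ℂ) →L[ℝ] ℝ :=
  LinearMap.toContinuousLinearMap
    { toFun := fsPot y
      map_add' := fun w w' ↦ by
        simp only [fsPot, hdot_add_right, Complex.add_im, add_div]
      map_smul' := fun c w ↦ by
        simp only [fsPot, hdot_real_smul_right, Complex.im_ofReal_mul, smul_eq_mul,
          RingHom.id_apply, mul_div_assoc] }

/-- `fsPotL y w = β_y(w)`. [cite: HuybrechtsCG2005, §3.1 Examples 3.1.9 i) pp. 117–118] -/
@[simp]
theorem fsPotL_apply (y w : Fin n → ℂ) : fsPotL y w = fsPot y w :=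
  rfl

/-- The potential `β` as a `1`-form on `ℂⁿ` in Mathlib's sense (`E → E [⋀^Fin 1]→L[ℝ] ℝ`, via
`ContinuousAlternatingMap.ofSubsingleton`).
[cite: HuybrechtsCG2005, §3.1 Examples 3.1.9 i) pp. 117–118] -/
def fsPotForm (y : Fin n → ℂ) : (Fin n → ℂ) [⋀^Fin 1]→L[ℝ] ℝ :=
  ContinuousAlternatingMap.ofSubsingleton ℝ (Fin n → ℂ) ℝ (0 : Fin 1) (fsPotL y)

/-- `β_y [u] = β_y(u 0)`. [cite: HuybrechtsCG2005, §3.1 Examples 3.1.9 i) pp. 117–118] -/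
@[simp]
theorem fsPotForm_apply (y : Fin n → ℂ) (u : Fin 1 → Fin n → ℂ) :
    fsPotForm y u = fsPot y (u 0) :=
  rfl

/-- The coefficients `y ↦ β_y(w)` are smooth (`1 + ‖y‖² ≠ 0`).
[cite: HuybrechtsCG2005, §3.1 Examples 3.1.9 i) pp. 117–118] -/
theorem contDiff_fsPot {k : WithTop ℕ∞} (w : Fin n → ℂ) :
    ContDiff ℝ k fun y : Fin n → ℂ ↦ fsPot y w := by
  unfold fsPot
  refine ContDiff.div ?_ ?_ fun y ↦ (mul_pos two_pos (one_add_nsq_pos y)).ne'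
  · exact Complex.imCLM.contDiff.comp (contDiff_hdot_left w)
  · exact contDiff_const.mul (contDiff_const.add contDiff_nsq)

/-- `y ↦ β_y` is smooth as a map to the dual space (finite dimension: `contDiff_clm_apply_iff`).
[cite: HuybrechtsCG2005, §3.1 Examples 3.1.9 i) pp. 117–118] -/
theorem contDiff_fsPotL {k : WithTop ℕ∞} : ContDiff ℝ k (fsPotL : (Fin n → ℂ) → _) :=
  contDiff_clm_apply_iff.2 fun w ↦ contDiff_fsPot w

/-- `β` is a smooth `1`-form. [cite: HuybrechtsCG2005, §3.1 Examples 3.1.9 i) pp. 117–118] -/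
theorem contDiff_fsPotForm {k : WithTop ℕ∞} : ContDiff ℝ k (fsPotForm : (Fin n → ℂ) → _) :=
  (ContinuousAlternatingMap.ofSubsingletonLIE (𝕜 := ℝ) (E := Fin n → ℂ) (F := ℝ)
    (0 : Fin 1)).contDiff.comp contDiff_fsPotL

/-- The directional derivatives of the coefficients of `β`: `D_u β_·(w) = Im⟨u,w⟩/(2(1+‖y‖²)) -
Im⟨y,w⟩ Re⟨y,u⟩/(1+‖y‖²)²`. [cite: HuybrechtsCG2005, §3.1 Examples 3.1.9 i) pp. 117–118] -/
theorem fderiv_fsPot_apply (y w u : Fin n → ℂ) :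
    fderiv ℝ (fun y ↦ fsPot y w) y u =
      (hdot u w).im / (2 * (1 + nsq y)) - (hdot y w).im * (hdot y u).re / (1 + nsq y) ^ 2 := by
  have hN := one_add_nsq_pos y
  have hA : HasFDerivAt (fun y : Fin n → ℂ ↦ (hdot y w).im)
      (Complex.imCLM.comp (hdotB.flip w)) y :=
    Complex.imCLM.hasFDerivAt.comp y (hdotB.flip w).hasFDerivAt
  have hB : HasFDerivAt (fun y : Fin n → ℂ ↦ 2 * (1 + nsq y))
      ((2 : ℝ) • ((2 : ℝ) • Complex.reCLM.comp (hdotB y))) y :=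
    ((hasFDerivAt_nsq y).const_add 1).const_mul 2
  have hBinv := (hasDerivAt_inv (mul_pos two_pos hN).ne').comp_hasFDerivAt y hB
  have h := hA.mul hBinv
  have hfun : (fun y ↦ fsPot y w) = (fun y : Fin n → ℂ ↦ (hdot y w).im) *
      ((fun x : ℝ ↦ x⁻¹) ∘ fun y : Fin n → ℂ ↦ 2 * (1 + nsq y)) := by
    funext y
    simp [fsPot, div_eq_mul_inv]
  rw [hfun, h.fderiv]
  simp only [add_apply, smul_apply, ContinuousLinearMap.comp_apply,
    ContinuousLinearMap.flip_apply, hdotB_apply, Complex.imCLM_apply, Complex.reCLM_apply,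
    smul_eq_mul, Function.comp_apply]
  field_simp
  ring

/-- `dβ(v₀, v₁) = D_{v₀} β(v₁) - D_{v₁} β(v₀)` (Mathlib's normalisation of `extDeriv`).
[folklore] -/
theorem extDeriv_fsPotForm_apply (y : Fin n → ℂ) (v : Fin 2 → Fin n → ℂ) :
    extDeriv fsPotForm y v =
      fderiv ℝ (fun y ↦ fsPot y (v 1)) y (v 0) - fderiv ℝ (fun y ↦ fsPot y (v 0)) y (v 1) := by
  rw [extDeriv_apply (contDiff_fsPotForm (k := 1)).contDiffAt.differentiableAt_one]
  simp [Fin.sum_univ_two, Fin.removeNth, sub_eq_add_neg]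

/-- **The Fubini–Study form is exact on each affine chart**: `dβ(v, w) = Im h_y(v, w)` — Huybrechts'
`ωᵢ = (i/2π)∂∂̄ log(1 + Σ|w_k|²)` with `∂∂̄ = -d∂`, p. 117, as an identity of real `2`-forms; in
particular the chart form is closed (`d ∘ d = 0`).
[cite: HuybrechtsCG2005, §3.1 Examples 3.1.9 i) pp. 117–118] -/
theorem extDeriv_fsPotForm_apply_eq (y : Fin n → ℂ) (v : Fin 2 → Fin n → ℂ) :
    extDeriv fsPotForm y v = (fsE y (v 0) (v 1)).im := by
  rw [extDeriv_fsPotForm_apply, fderiv_fsPot_apply, fderiv_fsPot_apply, fsE_im,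
    ← hdot_conj_symm y (v 0), ← hdot_conj_symm (v 0) (v 1)]
  have hN := one_add_nsq_pos y
  simp only [Complex.mul_im, Complex.conj_re, Complex.conj_im]
  field_simp
  ring

/-- The chart metric `y ↦ g_y` is smooth as a map into continuous bilinear forms (finite dimension:
`contDiff_clm_apply_iff` twice; the coefficients are rational functions with denominator
`(1+‖y‖²)²`). [cite: HuybrechtsCG2005, §3.1 Examples 3.1.9 i) pp. 117–118] -/
theorem contDiff_gE {k : WithTop ℕ∞} : ContDiff ℝ k (gE : (Fin n → ℂ) → _) := by
  refine contDiff_clm_apply_iff.2 fun v ↦ contDiff_clm_apply_iff.2 fun w ↦ ?_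
  have h : (fun y ↦ gE y v w) = fun y ↦
      (hdot v w).re / (1 + nsq y) - (hdot v y * hdot y w).re / (1 + nsq y) ^ 2 := by
    funext y
    rw [gE_apply, fsE_re]
  rw [h]
  refine ContDiff.sub ?_ ?_
  · exact contDiff_const.div (contDiff_const.add contDiff_nsq) fun y ↦
      (one_add_nsq_pos y).ne'
  · refine ContDiff.div ?_ ((contDiff_const.add contDiff_nsq).pow 2) fun y ↦
      (pow_pos (one_add_nsq_pos y) 2).ne'
    exact Complex.reCLM.contDiff.comp ((contDiff_hdot_right v).mul (contDiff_hdot_left w))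

end Calculus


/-! ### The Fubini–Study metric on `ℙⁿ(ℂ)` -/

section Manifold

open scoped Manifold ContDiff Topology LinearAlgebra.Projectivization
open Bundle Literature.Geometry.Kaehler Literature.NumberTheory.Transcendental

variable {n : ℕ}

/-- The index of the preferred chart at `p ∈ ℙⁿ(ℂ)`: `chartAt p = stdChart (cidx p)` (the choice made
by `Projectivization.instChartedSpace`). [folklore] -/
def cidx (p : ℙ ℂ (Fin (n + 1) → ℂ)) : Fin (n + 1) :=
  Classical.choose (exists_rep_apply_ne_zero p)

/-- `chartAt p = stdChart (cidx p)`. [folklore] -/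
theorem chartAt_eq_stdChart_cidx (p : ℙ ℂ (Fin (n + 1) → ℂ)) :
    chartAt (Fin n → ℂ) p = stdChart (cidx p) :=
  rfl

/-- `p ∈ U_{cidx p}`. [folklore] -/
theorem mem_stdChartSource_cidx (p : ℙ ℂ (Fin (n + 1) → ℂ)) : p ∈ stdChartSource (cidx p) :=
  Classical.choose_spec (exists_rep_apply_ne_zero p)

/-- For `p = φᵢ⁻¹ y`: `(σᵢ y)_{cidx p} ≠ 0`, i.e. `y ∈ φᵢ(Uᵢ ∩ U_{cidx p})`. [folklore] -/
theorem insertNth_one_cidx_ne_zero (i : Fin (n + 1)) (y : Fin n → ℂ) :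
    (Fin.insertNth i (1 : ℂ) y : Fin (n + 1) → ℂ) (cidx (stdChartInv i y)) ≠ 0 := by
  have h := mem_stdChartSource_cidx (stdChartInv i y)
  rwa [stdChartInv, mk_mem_stdChartSource_iff] at h

/-- The extended chart at `x₀` is `φ_{cidx x₀}` (model with corners `𝓘`). [folklore] -/
@[simp]
theorem extChartAt_apply' (x₀ x : ℙ ℂ (Fin (n + 1) → ℂ)) :
    extChartAt 𝓘(ℝ, Fin n → ℂ) x₀ x = stdChartFun (cidx x₀) x :=
  rfl

/-- The inverse extended chart at `x₀` is `φ_{cidx x₀}⁻¹ = [σ_{cidx x₀} ·]`. [folklore] -/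
@[simp]
theorem extChartAt_symm_apply' (x₀ : ℙ ℂ (Fin (n + 1) → ℂ)) (y : Fin n → ℂ) :
    (extChartAt 𝓘(ℝ, Fin n → ℂ) x₀).symm y = stdChartInv (cidx x₀) y :=
  rfl

/-- **The Fubini–Study metric of `ℙⁿ(ℂ)`, pointwise** (Huybrechts, Examples 3.1.9 i); Griffiths–Harris
pp. 30–31): on Mathlib's tangent space `TangentSpace 𝓘(ℝ, ℂⁿ) p = ℂⁿ`, read in the frame of the
preferred chart `φ_{cidx p}`, it is the chart metric `g_{φ_{cidx p} p}`.
[cite: HuybrechtsCG2005, §3.1 Examples 3.1.9 i) pp. 117–118] -/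
def fubiniStudyInner (p : ℙ ℂ (Fin (n + 1) → ℂ)) :
    TangentSpace 𝓘(ℝ, Fin n → ℂ) p →L[ℝ] TangentSpace 𝓘(ℝ, Fin n → ℂ) p →L[ℝ] ℝ :=
  gE (stdChartFun (cidx p) p)

/-- Gluing for the pointwise metric: at `p = φᵢ⁻¹ y`, `g_p(D v, D w) = g_y(v, w)` with `D` the
derivative of `φ_{cidx p} ∘ φᵢ⁻¹` at `y` (`fsE_transition`, real part).
[cite: HuybrechtsCG2005, §3.1 Examples 3.1.9 i) pp. 117–118] -/
theorem fubiniStudyInner_stdChartInv_apply (i : Fin (n + 1)) (y : Fin n → ℂ) (v w : Fin n → ℂ) :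
    fubiniStudyInner (stdChartInv i y)
        (fderiv ℝ (stdChartFun (cidx (stdChartInv i y)) ∘ stdChartInv i :
          (Fin n → ℂ) → Fin n → ℂ) y v)
        (fderiv ℝ (stdChartFun (cidx (stdChartInv i y)) ∘ stdChartInv i :
          (Fin n → ℂ) → Fin n → ℂ) y w) = gE y v w :=
  congrArg Complex.re (fsE_transition _ _ (insertNth_one_cidx_ne_zero i y) v w)

/- From here on Mathlib's real tangent bundle of `ℙⁿ(ℂ)` is used, which needs the real `C^∞`
manifold structure; it is a section hypothesis, fed `isManifold_real_of_isManifold_complex` (under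
the fact's own hypothesis `isManifold_projectivization ℂ n`) in the discharge below. -/
variable [IsManifold 𝓘(ℝ, Fin n → ℂ) ∞ (ℙ ℂ (Fin (n + 1) → ℂ))]

/-- **Tangent coordinate changes of `ℙⁿ(ℂ)`.** The inverse trivialization of Mathlib's real tangent
bundle at `x₀`, at the point `φ_{cidx x₀}⁻¹ y` of the chart domain, is the real derivative at `y`
of the transition map `φ_{cidx x} ∘ φ_{cidx x₀}⁻¹`, `x = φ_{cidx x₀}⁻¹ y`
(`TangentBundle.symmL_trivializationAt_eq_core`, `tangentBundleCore_coordChange_achart`).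
[folklore] -/
theorem symmL_trivializationAt_eq (x₀ : ℙ ℂ (Fin (n + 1) → ℂ)) (y : Fin n → ℂ) :
    (trivializationAt (Fin n → ℂ) (TangentSpace 𝓘(ℝ, Fin n → ℂ)) x₀).symmL ℝ
        (stdChartInv (cidx x₀) y) =
      fderiv ℝ (stdChartFun (cidx (stdChartInv (cidx x₀) y)) ∘ stdChartInv (cidx x₀) :
        (Fin n → ℂ) → Fin n → ℂ) y := by
  have hx : stdChartInv (cidx x₀) y ∈ (chartAt (Fin n → ℂ) x₀).source :=
    stdChartInv_mem_stdChartSource _ _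
  rw [TangentBundle.symmL_trivializationAt_eq_core hx, tangentBundleCore_coordChange_achart]
  simp only [extChartAt_coe, extChartAt_coe_symm, modelWithCornersSelf_coe,
    modelWithCornersSelf_coe_symm, Function.id_comp, Function.comp_id, Set.range_id,
    fderivWithin_univ, chartAt_eq_stdChart_cidx, Function.comp_apply, stdChart_apply,
    stdChartFun_stdChartInv]
  rfl

/-- The manifold derivative of the inverse extended chart at `x₀` (the push-forward used by
`Literature.Geometry.Kaehler.MForm.inChart`) is that same derivative of the transition map
(`TangentBundle.symmL_trivializationAt`). [folklore] -/
theorem mfderivWithin_extChartAt_symm_eq (x₀ : ℙ ℂ (Fin (n + 1) → ℂ)) (y : Fin n → ℂ) :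
    mfderivWithin 𝓘(ℝ, Fin n → ℂ) 𝓘(ℝ, Fin n → ℂ) (extChartAt 𝓘(ℝ, Fin n → ℂ) x₀).symm
        (Set.range 𝓘(ℝ, Fin n → ℂ)) y =
      fderiv ℝ (stdChartFun (cidx (stdChartInv (cidx x₀) y)) ∘ stdChartInv (cidx x₀) :
        (Fin n → ℂ) → Fin n → ℂ) y := by
  have hx : stdChartInv (cidx x₀) y ∈ (chartAt (Fin n → ℂ) x₀).source :=
    stdChartInv_mem_stdChartSource _ _
  have h := TangentBundle.symmL_trivializationAt (I := 𝓘(ℝ, Fin n → ℂ)) hx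
  rw [extChartAt_apply', stdChartFun_stdChartInv] at h
  rw [← h, symmL_trivializationAt_eq]

/-- **Smoothness of the Fubini–Study metric**: `p ↦ g_p` is a `C^∞` section of the bundle of bilinear
forms on the real tangent bundle. In the chart at `x₀` (index `i`), the trivialization conjugates
`g_x` by the inverse tangent trivialization (`trivializationAt_bilinForm_apply₂`), which is
`D(φ_{cidx x} ∘ φᵢ⁻¹)` (`symmL_trivializationAt_eq`), so by gluing the coordinate expression is `y
↦ g_y` on all of `ℂⁿ`, a smooth map (`contDiff_gE`).
[cite: HuybrechtsCG2005, §3.1 Examples 3.1.9 i) pp. 117–118] -/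
theorem contMDiff_fubiniStudyInner :
    ContMDiff 𝓘(ℝ, Fin n → ℂ)
      (𝓘(ℝ, Fin n → ℂ).prod 𝓘(ℝ, (Fin n → ℂ) →L[ℝ] (Fin n → ℂ) →L[ℝ] ℝ)) ∞
      (fun p : ℙ ℂ (Fin (n + 1) → ℂ) ↦ TotalSpace.mk' ((Fin n → ℂ) →L[ℝ] (Fin n → ℂ) →L[ℝ] ℝ)
        (E := fun p : ℙ ℂ (Fin (n + 1) → ℂ) ↦
          TangentSpace 𝓘(ℝ, Fin n → ℂ) p →L[ℝ] TangentSpace 𝓘(ℝ, Fin n → ℂ) p →L[ℝ] ℝ)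
        p (fubiniStudyInner p)) := by
  intro x₀
  rw [contMDiffAt_section, contMDiffAt_iff_source, contMDiffWithinAt_iff_contDiffWithinAt]
  have key : (fun x ↦ (trivializationAt ((Fin n → ℂ) →L[ℝ] (Fin n → ℂ) →L[ℝ] ℝ)
      (fun x : ℙ ℂ (Fin (n + 1) → ℂ) ↦
        TangentSpace 𝓘(ℝ, Fin n → ℂ) x →L[ℝ] TangentSpace 𝓘(ℝ, Fin n → ℂ) x →L[ℝ] ℝ) x₀
          ⟨x, fubiniStudyInner x⟩).2) ∘ (extChartAt 𝓘(ℝ, Fin n → ℂ) x₀).symm =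
      fun y ↦ gE y := by
    funext y
    ext v w
    rw [Function.comp_apply, trivializationAt_bilinForm_apply₂, extChartAt_symm_apply',
      symmL_trivializationAt_eq]
    exact fubiniStudyInner_stdChartInv_apply _ y v w
  rw [key]
  exact contDiff_gE.contDiffAt.contDiffWithinAt

/-- **The Fubini–Study metric of `ℙⁿ(ℂ)`** (Huybrechts, §3.1 Examples 3.1.9 i), pp. 117–118;
Griffiths–Harris pp. 30–31) as a `C^∞` Riemannian metric on Mathlib's real tangent bundle of `ℙ ℂ
ℂⁿ⁺¹`: inner products `fubiniStudyInner`, symmetric (`gE_symm`), positive definite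
(`gE_self_pos`), with bounded unit balls (`norm_sq_le_of_gE_self_lt_one`) and smooth
(`contMDiff_fubiniStudyInner`). [cite: HuybrechtsCG2005, §3.1 Examples 3.1.9 i) pp. 117–118] -/
def fubiniStudyMetric :
    ContMDiffRiemannianMetric 𝓘(ℝ, Fin n → ℂ) ∞ (Fin n → ℂ)
      (fun x : ℙ ℂ (Fin (n + 1) → ℂ) ↦ TangentSpace 𝓘(ℝ, Fin n → ℂ) x) where
  inner := fubiniStudyInner
  symm b v w := gE_symm _ _ _
  pos b v hv := gE_self_pos _ hv
  isVonNBounded b := by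
    change Bornology.IsVonNBounded ℝ {v : Fin n → ℂ | gE (stdChartFun (cidx b) b) v v < 1}
    refine (NormedSpace.isVonNBounded_ball ℝ (Fin n → ℂ)
      (1 + nsq (stdChartFun (cidx b) b))).subset ?_
    intro v hv
    exact mem_ball_zero_iff.2 (norm_sq_le_of_gE_self_lt_one _ hv)
  contMDiff := contMDiff_fubiniStudyInner

/-- The inner product of `fubiniStudyMetric` at `p` is `g_{φ_{cidx p} p}`.
[cite: HuybrechtsCG2005, §3.1 Examples 3.1.9 i) pp. 117–118] -/
theorem fubiniStudyMetric_inner (p : ℙ ℂ (Fin (n + 1) → ℂ)) :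
    (fubiniStudyMetric (n := n)).toRiemannianMetric.inner p = gE (stdChartFun (cidx p) p) :=
  rfl

/-- The Fubini–Study metric is Hermitian, `g(Jv, Jw) = g(v, w)` (`ω_FS` is a real `(1,1)`-form,
Huybrechts p. 117). [cite: HuybrechtsCG2005, §3.1 Examples 3.1.9 i) pp. 117–118] -/
theorem isHermitian_fubiniStudyMetric :
    (fubiniStudyMetric (n := n)).toRiemannianMetric.IsHermitian := by
  intro x v w
  rw [fubiniStudyMetric_inner, tangentJ_apply, tangentJ_apply]
  exact gE_I_smul_I_smul _ _ _

/-- **The chart representative of the Kähler form is `dβ`.** In the chart at `x₀` (index `i`), for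
every `y ∈ ℂⁿ`, the representative (`MForm.inChart`) of the Kähler form `ω(v, w) = g(Jv, w)` of
the Fubini–Study metric is `Im h_y = dβ_y`: the push-forward by `φᵢ⁻¹` is `D(φ_{cidx x} ∘ φᵢ⁻¹)`
(`mfderivWithin_extChartAt_symm_eq`), `g(J·, ·) = Im h` (`re_fsE_I_smul_left`), gluing
(`fsE_transition`) and exactness (`extDeriv_fsPotForm_apply_eq`).
[cite: HuybrechtsCG2005, §3.1 Examples 3.1.9 i) pp. 117–118] -/
theorem inChart_kaehlerForm_fubiniStudyMetric (x₀ : ℙ ℂ (Fin (n + 1) → ℂ)) :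
    (fubiniStudyMetric (n := n)).toRiemannianMetric.kaehlerForm.inChart x₀ =
      extDeriv fsPotForm := by
  funext y
  ext v
  set i : Fin (n + 1) := cidx x₀ with hi
  set D : (Fin n → ℂ) →L[ℝ] (Fin n → ℂ) :=
    fderiv ℝ (stdChartFun (cidx (stdChartInv i y)) ∘ stdChartInv i : (Fin n → ℂ) → Fin n → ℂ) y
    with hD
  have hM : mfderivWithin 𝓘(ℝ, Fin n → ℂ) 𝓘(ℝ, Fin n → ℂ) (extChartAt 𝓘(ℝ, Fin n → ℂ) x₀).symm
      (Set.range 𝓘(ℝ, Fin n → ℂ)) y = D :=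
    mfderivWithin_extChartAt_symm_eq x₀ y
  have hvec : (fun k ↦ mfderivWithin 𝓘(ℝ, Fin n → ℂ) 𝓘(ℝ, Fin n → ℂ)
      (extChartAt 𝓘(ℝ, Fin n → ℂ) x₀).symm (Set.range 𝓘(ℝ, Fin n → ℂ)) y (v k)) =
      ![D (v 0), D (v 1)] := by
    funext k
    rw [hM]
    fin_cases k <;> rfl
  calc (fubiniStudyMetric (n := n)).toRiemannianMetric.kaehlerForm.inChart x₀ y v
      = (fubiniStudyMetric (n := n)).toRiemannianMetric.kaehlerForm (stdChartInv i y)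
          ![D (v 0), D (v 1)] := by
        rw [MForm.inChart_apply, hvec]
        rfl
    _ = (fubiniStudyMetric (n := n)).toRiemannianMetric.inner (stdChartInv i y)
          (tangentJ (Fin n → ℂ) (stdChartInv i y) (D (v 0))) (D (v 1)) :=
        Bundle.RiemannianMetric.kaehlerForm_apply_of_isHermitian _ isHermitian_fubiniStudyMetric
          _ _ _
    _ = (fsE (stdChartFun (cidx (stdChartInv i y)) (stdChartInv i y))
          (I • D (v 0)) (D (v 1))).re := rfl
    _ = (fsE y (v 0) (v 1)).im := by
        rw [re_fsE_I_smul_left, hD, fsE_transition _ _ (insertNth_one_cidx_ne_zero i y)]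
    _ = extDeriv fsPotForm y v := (extDeriv_fsPotForm_apply_eq y v).symm

/-- **The Kähler form of the Fubini–Study metric is closed** (`dω_FS = 0`, Huybrechts p. 117), for the
manifold exterior derivative `Literature.Geometry.Kaehler.mextDeriv`: at each `x₀` it is `d(dβ) =
0` in the chart (`inChart_kaehlerForm_fubiniStudyMetric`, Mathlib's `extDeriv_extDeriv`).
[cite: HuybrechtsCG2005, §3.1 Examples 3.1.9 i) pp. 117–118] -/
theorem isClosedForm_kaehlerForm_fubiniStudyMetric :
    IsClosedForm (fubiniStudyMetric (n := n)).toRiemannianMetric.kaehlerForm := by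
  unfold IsClosedForm
  funext x₀
  have hr : minSmoothness ℝ 2 ≤ ∞ := by
    rw [minSmoothness_of_isRCLikeNormedField]
    exact WithTop.coe_le_coe.2 le_top
  simp only [mextDeriv, inChart_kaehlerForm_fubiniStudyMetric, modelWithCornersSelf_coe,
    Set.range_id, extDerivWithin_univ, extDeriv_extDeriv (contDiff_fsPotForm (k := ∞)) hr]
  rfl

/-- **The Fubini–Study metric is Kähler** (Huybrechts, Examples 3.1.9 i): "The Fubini–Study metric is
a canonical Kähler metric on the projective space `ℙⁿ`").
[cite: HuybrechtsCG2005, §3.1 Examples 3.1.9 i) pp. 117–118] -/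
theorem isKaehler_fubiniStudyMetric :
    (fubiniStudyMetric (n := n)).toRiemannianMetric.IsKaehler :=
  ⟨isHermitian_fubiniStudyMetric, isClosedForm_kaehlerForm_fubiniStudyMetric⟩

/-- **Discharge of the named fact `isKaehlerManifold_projectivization`** (`GAGA.lean`): complex
projective space `ℙⁿ(ℂ) = ℙ ℂ ℂⁿ⁺¹`, with the standard atlas of `ProjectiveSpace.lean` and the
manifold structures installed in the fact by `haveI`, is a Kähler manifold
(`Literature.Geometry.Kaehler.IsKaehlerManifold`): the Fubini–Study metric `fubiniStudyMetric` is
a smooth Hermitian metric with closed Kähler form (`isKaehler_fubiniStudyMetric`). Huybrechts,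
*Complex Geometry*, §3.1 Examples 3.1.9 i), pp. 117–118; Griffiths–Harris, *Principles of
Algebraic Geometry*, pp. 30–31, 109 (the fact's locator); Voisin I, Ex. 3.10. The fact's
hypothesis `h : isManifold_projectivization ℂ n` (the theorem `isManifold_projectivization_holds`)
supplies, via `isManifold_real_of_isManifold_complex`, the real manifold structure under which the
metric is built.
[cite: HuybrechtsCG2005, §3.1 Examples 3.1.9 i) pp. 117–118] [cite: GriffithsHarris1978, pp. 30–31] -/
theorem _root_.Literature.AlgebraicGeometry.Motives.isKaehlerManifold_projectivization_holds :
    isKaehlerManifold_projectivization := by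
  intro n h
  haveI : IsManifold 𝓘(ℂ, Fin n → ℂ) ω (ℙ ℂ (Fin (n + 1) → ℂ)) := h
  haveI : IsManifold 𝓘(ℝ, Fin n → ℂ) ∞ (ℙ ℂ (Fin (n + 1) → ℂ)) :=
    isManifold_real_of_isManifold_complex
  exact ⟨⟨fubiniStudyMetric, isKaehler_fubiniStudyMetric⟩⟩

end Manifold

end FubiniStudy

end Literature.AlgebraicGeometry.Motives
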